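import Mathlib
import Summits.ResolutionOfSingularities.ResolutionOfSingularities.Theorems.WildQuotientsWildQuotientResolutionZ9PeeledRootChartAGraded
import Summits.ResolutionOfSingularities.ResolutionOfSingularities.Theorems.WildQuotientsWildQuotientResolutionZ9PeeledRootChartARing
import Summits.ResolutionOfSingularities.ResolutionOfSingularities.Theorems.WildQuotientsWildQuotientResolutionZ9PeeledI28Stable
import Summits.ResolutionOfSingularities.ResolutionOfSingularities.Theorems.WildQuotientsWildQuotientResolutionZ9PeeledCoverThree
import Summits.ResolutionOfSingularities.ResolutionOfSingularities.Theorems.WildQuotientsWildQuotientResolutionBlowupExitBasicOpenSections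
import Literature.AlgebraicGeometry.Limits.ClosedSubschemes

/-!
# The ℤ9 specimen, piece `P₀ = D₊(x_a⁴ t)`: the Bergh–Rydh chart PACKAGE (`hchart` datum of the Z6 frame)

(crux stmt-ResolutionOfSingularities-15640 `WildQuotients.WildQuotientResolution`, S1 = stmt-…-17941; ℤ9
SPECIMEN brick Z6 (V-BR) of res-L1-w45c-idea-2's `cardP_g12/Z9-SPECIMEN.md` §2/§4; res-L1-w45c-stub-1
TAKING 2026-08-27T18:28:03Z «P₀ PACKAGE». [OURS · L1 W4.5c] — assembly of landed decls, NOT a statement of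
any manuscript: the SEAM `BlowupExit.exists_basicOpen_sectionsEquiv` (res-L1-w45c-lead-1) at `s₀ = x_a⁴ t` over
res-D-pv-033's `smul_I28_pointwise`/`smul_g0_eq`, the ring side `exists_ringEquiv_chartRingA_weightZero` /
`chartA_seamFixed_iff` (res-L1-w45c-stub-1), the root lift `ξ`, its intertwining `aeval_rootSubstA_comp` and
K–L regularity (res-L1-w45c-stub-3), the graded K–L ring `exists_gradedAlgebra_rootLiftA_fixedPoints`.
Prover res-L1-w45c-stub-1. Def-free.)

* `app_comp_appLE_top` — bookkeeping: `h^* (f^*|_{⊤} z) = (h ≫ f)^*|_{h⁻¹ ⊤} z`;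
* **`rootChartA_package`** — for the peeled action `σ̄` (laws `h0 hb hc hd hσ`), the scaffold
  `(ρ hρ hJ ρB hρB)` of `V = Bl_{I₂₈} 𝔸ⁿ` and a stable affine piece `P0` with `P0.1 = D₊(x_a⁴ t)`:
  THE `hchart` DATUM of `PeelingFrame.hasResolution_glued_liftAction_of_pieceGradedCharts` at `P0` — a
  finite-type REGULAR `k`-algebra `S = k[x]^⟨ξ⟩` graded by `ZMod 7` with
  `e : 𝒮 0 ≃+* Γ(P0)^⟨σ̄⟩ = (ρB|_{P0}).invariants.ring ⊤`, compatible with the `k`-structures.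
-/

-- single-problem summit: the doubled namespace component `ResolutionOfSingularities` is forced
set_option linter.dupNamespace false

noncomputable section

open CategoryTheory AlgebraicGeometry TopologicalSpace MvPolynomial Polynomial HomogeneousLocalization
open Literature.AlgebraicGeometry.Resolution Literature.AlgebraicGeometry.RelativeSpec
open scoped Pointwise

namespace Summit.ResolutionOfSingularities.ResolutionOfSingularities.Theorems.WildQuotientResolution.Z9Peeled

/-- Bookkeeping: `h^* (f^*|_{⊤ ≤ ⊤} z) = (h ≫ f)^*|_{h⁻¹ ⊤} z`. [folklore] -/
theorem app_comp_appLE_top {X Y Z : Scheme.{0}} (h : X ⟶ Y) (f : Y ⟶ Z) (z : Γ(Z, ⊤)) :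
    h.app ⊤ (f.appLE ⊤ ⊤ le_top z) = (h ≫ f).appLE ⊤ (h ⁻¹ᵁ ⊤) le_top z := by
  rw [Scheme.Hom.app_eq_appLE, ← CommRingCat.comp_apply, Scheme.Hom.appLE_comp_appLE]

/-- Bookkeeping: `(Spec φ₀)^*|_{⊤ ≤ ⊤} (ι_k c) = ι_R (φ₀ c)` (`ΓSpecIso` naturality). [folklore] -/
theorem appLE_top_ΓSpecIso_inv {R S : CommRingCat.{0}} (φ₀ : R ⟶ S) (c : R) :
    (Spec.map φ₀).appLE ⊤ ⊤ le_top ((Scheme.ΓSpecIso R).inv c) = (Scheme.ΓSpecIso S).inv (φ₀ c) := by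
  change (Spec.map φ₀).appLE ⊤ ((Spec.map φ₀) ⁻¹ᵁ ⊤) le_rfl ((Scheme.ΓSpecIso R).inv c) = _
  rw [Scheme.Hom.appLE_eq_app, ← CommRingCat.comp_apply, ← CommRingCat.comp_apply,
    Scheme.ΓSpecIso_inv_naturality]
  rfl

/-- **Transport of the invariants along a seam** (pure ring bookkeeping, abstract types so that it
elaborates cheaply): `Ω : B ≃ Γ` carries `Fix ⊆ B` onto `Inv ⊆ Γ`, `eE : B ≃ E ⊆ P` carries `Fix` to the
`ξ`-fixed elements, and `T` is (a copy of) the `ξ`-fixed part of `E` inside `P`; then `T ≃+* Inv`,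
through `t ↦ Ω (eE⁻¹ (t))`. [folklore] -/
theorem exists_ringEquiv_invariants_of_seam {B Γ P E T : Type*} [CommRing B] [CommRing Γ] [CommRing P]
    [CommRing E] [CommRing T] (Ω : B ≃+* Γ) (Inv : Subring Γ) (Fix : B → Prop)
    (hinv : ∀ y, Ω y ∈ Inv ↔ Fix y) (eE : B ≃+* E) (ι : E →+* P) (hι : Function.Injective ι)
    (ξfix : P → Prop) (hfix : ∀ y, ξfix (ι (eE y)) ↔ Fix y)
    (val : T →+* P) (hval : Function.Injective val)
    (toE : T → E) (htoE : ∀ t, ι (toE t) = val t) (hvalfix : ∀ t, ξfix (val t))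
    (ofE : ∀ u : E, ξfix (ι u) → T) (hofE : ∀ u h, val (ofE u h) = ι u) :
    ∃ e : T ≃+* ↥Inv, ∀ t, ((e t : ↥Inv) : Γ) = Ω (eE.symm (toE t)) := by
  -- `toE` is a ring map (checked inside `P` through the injective `ι`)
  have hmul : ∀ t t', toE (t * t') = toE t * toE t' := fun t t' =>
    hι (by rw [map_mul, htoE, htoE, htoE, map_mul])
  have hadd : ∀ t t', toE (t + t') = toE t + toE t' := fun t t' =>
    hι (by rw [map_add, htoE, htoE, htoE, map_add])
  have hone : toE 1 = 1 := hι (by rw [htoE, map_one, map_one])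
  have hzero : toE 0 = 0 := hι (by rw [htoE, map_zero, map_zero])
  let toEHom : T →+* E :=
    { toFun := toE, map_one' := hone, map_mul' := hmul, map_zero' := hzero, map_add' := hadd }
  let ψ : T →+* Γ := Ω.toRingHom.comp (eE.symm.toRingHom.comp toEHom)
  have hψ : ∀ t, ψ t = Ω (eE.symm (toE t)) := fun _ => rfl
  have hmem : ∀ t, ψ t ∈ Inv := fun t => by
    rw [hψ, hinv, ← hfix, eE.apply_symm_apply, htoE]
    exact hvalfix t
  have hinj : Function.Injective ψ := by
    intro t t' h
    rw [hψ, hψ] at h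
    have h1 : toE t = toE t' := eE.symm.injective (Ω.injective h)
    exact hval (by rw [← htoE, ← htoE, h1])
  have hsurj : ∀ γ ∈ Inv, ∃ t, ψ t = γ := by
    intro γ hγ
    have hy : Fix (Ω.symm γ) := (hinv _).mp (by rwa [Ω.apply_symm_apply])
    have hu : ξfix (ι (eE (Ω.symm γ))) := (hfix _).mpr hy
    refine ⟨ofE _ hu, ?_⟩
    have h1 : toE (ofE _ hu) = eE (Ω.symm γ) := hι (by rw [htoE, hofE])
    rw [hψ, h1, eE.symm_apply_apply, Ω.apply_symm_apply]
  let ψ' : T →+* ↥Inv := ψ.codRestrict Inv hmem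
  have hbij : Function.Bijective ψ' := by
    refine ⟨fun t t' h => hinj (by simpa [ψ'] using congrArg Subtype.val h), fun γ => ?_⟩
    obtain ⟨t, ht⟩ := hsurj γ.1 γ.2
    exact ⟨t, Subtype.ext ht⟩
  exact ⟨RingEquiv.ofBijective ψ' hbij, fun t => rfl⟩

variable (k : Type) [Field k] (n : ℕ) (a b c d : Fin n)
  (hab : a ≠ b) (hac : a ≠ c) (had : a ≠ d) (hbc : b ≠ c) (hbd : b ≠ d) (hcd : c ≠ d)

/-- The exponent table of the 24 generators of `I₂₈` (res-D-pv-033's `e24`, verbatim). -/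
local notation3 "e24" => (![(4, 0, 0), (3, 2, 0), (3, 1, 3), (3, 0, 7), (2, 4, 0), (2, 3, 2), (2, 2, 6), (2, 1, 10), (2, 0, 14), (1, 6, 0), (1, 5, 1), (1, 4, 5), (1, 3, 9), (1, 2, 13), (1, 1, 17), (1, 0, 21), (0, 7, 0), (0, 6, 4), (0, 5, 8), (0, 4, 12), (0, 3, 16), (0, 2, 20), (0, 1, 24), (0, 0, 28)] : Fin 24 → ℕ × ℕ × ℕ)
/-- The `μ₇`-weight `w₇(a,b,c) = (1,3,6)`, `0` on the other letters (local shorthand). -/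
local notation3 "w₇" => (fun i : Fin n => if i = a then (1 : ZMod 7) else if i = b then 3
    else if i = c then 6 else 0)
/-- The root substitution `ψ₀` of the `x_a`-vertex chart (res-L1-w45c-stub-3's literal, verbatim). -/
local notation3 "r₇" => (fun i : Fin n => if i = a then X a ^ 7 else if i = b then X a ^ 4 * X b
    else if i = c then X a * X c else (X i : MvPolynomial (Fin n) k))
/-- the quotient map `q : 𝔸ⁿ → 𝔸ⁿ/⟨σ̄⟩` (local shorthand) -/
local notation3 "qq" σ => Spec.map (CommRingCat.ofHom (algebraMap
  (FixedPoints.subalgebra k (MvPolynomial (Fin n) k) ↥(Subgroup.zpowers σ)) (MvPolynomial (Fin n) k)))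

include hab hac had hbc hbd hcd in
-- the statement is long (literal binder types of the scaffold); elaboration needs head-room
set_option maxHeartbeats 4000000 in
set_option synthInstance.maxHeartbeats 400000 in
/-- **The Bergh–Rydh chart package of the piece `P₀ = D₊(x_a⁴ t)`** (the `hchart` datum of
`PeelingFrame.hasResolution_glued_liftAction_of_pieceGradedCharts` at `P0`): for the peeled action `σ̄`
and the scaffold of `V = Bl_{I₂₈} 𝔸ⁿ` (`ρ hρ hJ ρB hρB`), a stable affine piece `P0` with `P0.1 = D₊(x_a⁴ t)`
has ring of invariants `Γ(P0)^⟨σ̄⟩ ≅ 𝒮 0`, the `μ₇`-weight-`0` part of the finite-type REGULAR (char `3`)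
`ZMod 7`-graded K–L ring `S = k[x]^⟨ξ⟩` of the `x_a`-root chart, compatibly with the `k`-structures.
[OURS · L1 W4.5c] [folklore; assembly of landed decls] -/
theorem rootChartA_package [CharP k 3] (g : Fin 24 → MvPolynomial (Fin n) k)
    (hg : ∀ q, g q = X a ^ (e24 q).1 * X b ^ (e24 q).2.1 * X c ^ (e24 q).2.2)
    (σ : MvPolynomial (Fin n) k ≃ₐ[k] MvPolynomial (Fin n) k) [Finite ↥(Subgroup.zpowers σ)]
    (h0 : σ (X a) = X a) (hb : σ (X b) = X b + X a) (hc : σ (X c) = X c + X b)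
    (hd : σ (X d) = X d + X c ^ 3 - X a ^ 2 * X c) (hσ : ∀ i, i ≠ b → i ≠ c → i ≠ d → σ (X i) = X i)
    (ρ : ↥(Subgroup.zpowers σ) →* Aut (Spec (CommRingCat.of (MvPolynomial (Fin n) k))))
    (hρ : ∀ γ : ↥(Subgroup.zpowers σ), (ρ γ).hom = Spec.map (CommRingCat.ofHom
      ((MulSemiringAction.toRingEquiv (↥(Subgroup.zpowers σ)) (MvPolynomial (Fin n) k) γ⁻¹ :
        MvPolynomial (Fin n) k ≃+* MvPolynomial (Fin n) k) :
          MvPolynomial (Fin n) k →+* MvPolynomial (Fin n) k)))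
    (hJ : ∀ γ : ↥(Subgroup.zpowers σ),
      (affineBlowup.idealSheaf (Ideal.span (Set.range g))).comap (ρ γ).hom =
        affineBlowup.idealSheaf (Ideal.span (Set.range g)))
    (ρB : ActionOver (affineBlowup.π (Ideal.span (Set.range g)) ≫ qq σ) ↥(Subgroup.zpowers σ))
    (hρB : ρB.aut = (affineBlowup.isBlowup (Ideal.span (Set.range g))).liftAction ρ hJ)
    (P0 : ρB.StableAffineOpens)
    (hP0 : P0.1 = Proj.basicOpen (reesGrading (Ideal.span (Set.range g)))
      (reesT (g 0) (Ideal.subset_span (Set.mem_range_self 0)))) :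
    ∃ (A : Type) (_ : AddCommGroup A) (_ : Finite A) (_ : DecidableEq A)
      (S : Type) (_ : CommRing S) (_ : Algebra k S) (𝒮 : A → Submodule k S) (_ : GradedAlgebra 𝒮),
      Algebra.FiniteType k S ∧ IsRegularRing S ∧
      ∃ e : ↥(𝒮 0) ≃+* ↥((ρB.restrict P0.1 P0.2.1).invariants.ring ⊤),
        ∀ c : k, ((e (algebraMap k (𝒮 0) c) :
            ↥((ρB.restrict P0.1 P0.2.1).invariants.ring ⊤)) :
              Γ(P0.1, (P0.1.ι ≫ (affineBlowup.π (Ideal.span (Set.range g)) ≫ qq σ)) ⁻¹ᵁ ⊤)) =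
          (P0.1.ι ≫ (affineBlowup.π (Ideal.span (Set.range g)) ≫ qq σ)).app ⊤
            (((Spec.map (CommRingCat.ofHom (algebraMap k
              (FixedPoints.subalgebra k (MvPolynomial (Fin n) k) ↥(Subgroup.zpowers σ))))).appLE ⊤ ⊤
              le_top) ((Scheme.ΓSpecIso (.of k)).inv c)) := by
  classical
  -- NB: no `obtain`/`rcases` on the (large) main goal — `Exists.elim` + projections instead (heartbeats)
  -- (0) the root lift `ξ` and the weight-`0` subalgebra `E`
  refine (exists_rootLiftA k n a b c d hab hac had hbc hbd hcd).elim fun ξ hξall => ?_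
  have hξa := hξall.1
  have hξb := hξall.2.1
  have hξc := hξall.2.2.1
  have hξd := hξall.2.2.2.1
  have hξ := hξall.2.2.2.2
  let E : Subalgebra k (MvPolynomial (Fin n) k) :=
    { carrier := {f | IsWeightedHomogeneous w₇ f 0}
      mul_mem' := fun {x y} hx hy => by
        have h := IsWeightedHomogeneous.mul hx hy
        rwa [add_zero] at h
      one_mem' := isWeightedHomogeneous_one k w₇
      add_mem' := fun {x y} hx hy => hx.add hy
      zero_mem' := isWeightedHomogeneous_zero k w₇ 0
      algebraMap_mem' := fun r => isWeightedHomogeneous_C w₇ r }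
  have hE : ∀ f, f ∈ E ↔ IsWeightedHomogeneous w₇ f 0 := fun f => Iff.rfl
  -- (1) the ring side: `chartRing g 0 ≃ E`
  refine (exists_ringEquiv_chartRingA_weightZero k n hab hac hbc g hg w₇ (by simp)
    (by simp [hab.symm]) (by simp [hac.symm, hbc.symm]) (fun i hia hib hic => by simp [hia, hib, hic])
    E hE).elim fun eE heE => ?_
  have hbase := heE.1
  -- (2) the `φ`-family and the seam at `s₀ = x_a⁴ t`
  have h0mem : g 0 ∈ Ideal.span (Set.range g) := Ideal.subset_span ⟨0, rfl⟩
  refine (BlowupExit.exists_reesGradedHom_family (I := Ideal.span (Set.range g))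
    (smul_I28_pointwise k n a b c σ h0 hb hc g hg)).elim fun φ hφf => ?_
  have hφ := hφf.1
  have hf := hφf.2
  have hφs : ∀ γ, φ γ (reesT (g 0) h0mem) = reesT (g 0) h0mem := by
    intro γ
    refine BlowupExit.reesGradedHom_eq_self_of_monomial _ (g 0) (coe_reesT _ _) (φ γ) _ (hφ γ) ?_
    change (MulSemiringAction.toRingEquiv _ _ γ⁻¹) (g 0) = g 0
    rw [MulSemiringAction.toRingEquiv_apply_apply]
    exact smul_g0_eq k n a b c σ h0 g hg γ⁻¹
  have hP : ∀ γ, Submonoid.powers (reesT (g 0) h0mem) ≤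
      (Submonoid.powers (reesT (g 0) h0mem)).comap (φ γ) := by
    intro γ
    rintro _ ⟨m, rfl⟩
    exact ⟨m, by change _ ^ m = φ γ (_ ^ m); rw [map_pow, hφs γ]⟩
  refine (BlowupExit.exists_basicOpen_sectionsEquiv ρ hρ hJ (qq σ) ρB
    (fun γ => by rw [hρB]) (reesT (g 0) h0mem) (reesT_mem _ _) one_pos φ hφ hf hφs hP P0.1 P0.2.1
    hP0).elim fun Ω hΩ => ?_
  have hΩi := hΩ.1
  have hΩii := hΩ.2
  have hinv : ∀ y, Ω y ∈ (ρB.restrict P0.1 P0.2.1).invariantsRing ⊤ ↔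
      ∀ γ, HomogeneousLocalization.map (φ γ) (hP γ) y = y := fun y =>
    BlowupExit.mem_invariantsRing_iff_of_sectionsEquiv (qq σ) ρB _ φ hP P0.1 P0.2.1 Ω hΩii y
  -- (3) fixed ↔ fixed through `eE` (the intertwining `ψ₀ ∘ σ̄ = ξ ∘ ψ₀`)
  have hfix : ∀ y, ξ ((eE y : ↥E) : MvPolynomial (Fin n) k) = ((eE y : ↥E) : MvPolynomial (Fin n) k) ↔
      ∀ γ, HomogeneousLocalization.map (φ γ) (hP γ) y = y := fun y =>
    chartA_seamFixed_iff k n g hg σ h0 φ hφ hP E eE hbase ξ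
      (fun F => aeval_rootSubstA_comp k n a b c d hab hac had hbc hbd hcd σ ξ h0 hb hc hd hσ
        hξa hξb hξc hξd hξ F) y
  -- (4) the graded K–L ring
  refine (exists_gradedAlgebra_rootLiftA_fixedPoints k n a b c d hab hac had hbc hbd hcd ξ hξa hξb hξc
    hξd hξ).elim fun 𝒮 h𝒮ex => h𝒮ex.elim fun h𝒮 h𝒮all => ?_
  have hft := h𝒮all.1
  have hreg := h𝒮all.2.1
  have hmem := h𝒮all.2.2
  -- (5) transport of the invariants along the seam (abstract bookkeeping lemma)
  have hS0 : ∀ s : ↥(𝒮 0), IsWeightedHomogeneous w₇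
      ((s : ↥(FixedPoints.subalgebra k (MvPolynomial (Fin n) k) ↥(Subgroup.zpowers ξ))) :
        MvPolynomial (Fin n) k) 0 := fun s => (hmem 0 s.1).mp s.2
  let val : ↥(𝒮 0) →+* MvPolynomial (Fin n) k :=
    (FixedPoints.subalgebra k (MvPolynomial (Fin n) k) ↥(Subgroup.zpowers ξ)).val.toRingHom.comp
      (algebraMap ↥(𝒮 0) ↥(FixedPoints.subalgebra k (MvPolynomial (Fin n) k) ↥(Subgroup.zpowers ξ)))
  have hval : ∀ s, val s = ((s : ↥(FixedPoints.subalgebra k (MvPolynomial (Fin n) k)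
      ↥(Subgroup.zpowers ξ))) : MvPolynomial (Fin n) k) := fun _ => rfl
  refine (exists_ringEquiv_invariants_of_seam (B := chartRing g 0) (P := MvPolynomial (Fin n) k) (E := ↥E)
    (T := ↥(𝒮 0)) Ω ((ρB.restrict P0.1 P0.2.1).invariants.ring ⊤)
    (fun y => ∀ γ, HomogeneousLocalization.map (φ γ) (hP γ) y = y) hinv eE E.val.toRingHom
    Subtype.val_injective (fun f => ξ f = f) hfix val
    (fun s t h => by rw [hval, hval] at h; exact Subtype.ext (Subtype.ext h))
    (fun s => ⟨((s : ↥(FixedPoints.subalgebra k (MvPolynomial (Fin n) k) ↥(Subgroup.zpowers ξ))) :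
      MvPolynomial (Fin n) k), (hE _).mpr (hS0 s)⟩) (fun s => by rw [hval]; rfl)
    (fun s => by rw [hval]; exact (TameTransfer.mem_fixedPoints_zpowers_iff_apply_eq ξ _).mp s.1.2)
    (fun u hu => ⟨⟨(u : MvPolynomial (Fin n) k),
      (TameTransfer.mem_fixedPoints_zpowers_iff_apply_eq ξ _).mpr hu⟩, (hmem 0 _).mpr ((hE _).mp u.2)⟩)
    (fun u hu => by rw [hval]; rfl)).elim fun e he => ?_
  refine ⟨ZMod 7, inferInstance, inferInstance, inferInstance,
    ↥(FixedPoints.subalgebra k (MvPolynomial (Fin n) k) ↥(Subgroup.zpowers ξ)), inferInstance,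
    inferInstance, 𝒮, h𝒮, hft, hreg, e, fun r => ?_⟩
  -- (6) compatibility with the `k`-structures
  refine (he (algebraMap k (𝒮 0) r)).trans ?_
  -- `eE⁻¹ (C r) = (C r)/1`
  have hC : eE.symm ⟨((algebraMap k ↥(𝒮 0) r :
      ↥(FixedPoints.subalgebra k (MvPolynomial (Fin n) k) ↥(Subgroup.zpowers ξ))) : MvPolynomial (Fin n) k),
      (hE _).mpr (hS0 _)⟩ = chartBase g 0 (C r) := by
    apply eE.injective
    rw [eE.apply_symm_apply]
    apply Subtype.ext
    rw [hbase, algHom_C]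
    rfl
  rw [hC]
  -- the seam (i): `Ω ((C r)/1) = (P0 ↪ V → 𝔸ⁿ)^*(C r)`
  have hi := hΩi (C r : MvPolynomial (Fin n) k)
  change Ω (chartBase g 0 (C r)) = _ at hi
  rw [hi, app_comp_appLE_top]
  -- `q ≫ (Spec k-structure of 𝔸ⁿ/σ̄) = Spec (k → k[x])`
  have hqf : (qq σ) ≫ Spec.map (CommRingCat.ofHom (algebraMap k
      (FixedPoints.subalgebra k (MvPolynomial (Fin n) k) ↥(Subgroup.zpowers σ)))) =
      Spec.map (CommRingCat.ofHom (algebraMap k (MvPolynomial (Fin n) k))) := by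
    rw [← Spec.map_comp, ← CommRingCat.ofHom_comp, ← IsScalarTower.algebraMap_eq]
  have hmor : (P0.1.ι ≫ (affineBlowup.π (Ideal.span (Set.range g)) ≫ qq σ)) ≫
      Spec.map (CommRingCat.ofHom (algebraMap k
        (FixedPoints.subalgebra k (MvPolynomial (Fin n) k) ↥(Subgroup.zpowers σ)))) =
      (P0.1.ι ≫ affineBlowup.π (Ideal.span (Set.range g))) ≫
        Spec.map (CommRingCat.ofHom (algebraMap k (MvPolynomial (Fin n) k))) := by
    simp only [Category.assoc, hqf]
  rw [Literature.AlgebraicGeometry.Limits.appLE_congr_hom_apply hmor,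
    ← Scheme.Hom.appLE_comp_appLE (P0.1.ι ≫ affineBlowup.π (Ideal.span (Set.range g)))
      (Spec.map (CommRingCat.ofHom (algebraMap k (MvPolynomial (Fin n) k)))) ⊤ ⊤ _ le_top
      (le_top.trans_eq (Opens.map_top _).symm),
    CommRingCat.comp_apply, appLE_top_ΓSpecIso_inv]
  rfl

end Summit.ResolutionOfSingularities.ResolutionOfSingularities.Theorems.WildQuotientResolution.Z9Peeled

end
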